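import Mathlib
import Summits.Ventures.PercRepro2.Defs
import Summits.Ventures.PercRepro2.Graph
import Summits.Ventures.PercRepro2.OneColourSwitch
import Summits.Ventures.PercRepro2.SideSwitch
import Summits.Ventures.PercRepro2.SideSwitchCompsM9
import Summits.Ventures.PercRepro2.M9PendantSeries

/-!
# `m9` on the class «every non-mark is adjacent to `p` or `q`, or has at most two non-loop
edges» (blind cell PercRepro2, p3 g19, 2026-08-27)

The class theorem `m9SignSum_nonpos_of_adj_or_degree_le_two`: `Σ_{Sep} σ_pq · σ_rs ≤ 0` whenever
every vertex other than `p, q, r, s` is adjacent to `p` or to `q`, or carries at most two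
non-loop edges.  Proof: strong induction on the number of non-loop edges, using the two exact
reductions of `M9PendantSeries` — a non-mark with one non-loop edge is looped
(`m9SignSum_pendant`), one with two non-loop edges `{d, x}, {d, y}` is replaced by the edge
`{x, y}` (`m9SignSum_series`: `2 · m9 = m9(G₁) + m9(G₀)`, both graphs smaller) — until every
non-mark is adjacent to `p` or `q` or has at most one non-loop edge, where no non-mark is ever
doubly reached (`DZero_of_adj_or_degree_le_one`) and `m9SignSum_nonpos_of_DZero` applies.

This is the first class of the lane on which a non-mark CAN be doubly reached in a `Sep`
colouring (a vertex of degree two between `r` and `s` is), so the class is not a `DZero`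
class; the reductions move the doubly reached configurations onto smaller graphs.  Own work.
-/

namespace Summit.Ventures.PercRepro2

namespace M9Reduce

open OneColourSwitch SideSwitch Classical Finset

variable {V : Type*} {E : Type*}

section Degree

variable [Fintype E] (ends : E → Sym2 V)

/-- The non-loop edges at a vertex. -/
noncomputable def nonloopEdges (x : V) : Finset E :=
  univ.filter (fun e => x ∈ ends e ∧ ¬ (ends e).IsDiag)

/-- The number of non-loop edges of the graph. -/
noncomputable def nonloopCount : ℕ := (univ.filter (fun e => ¬ (ends e).IsDiag)).card

variable {ends}

/-- Membership in the non-loop edges at `x`. -/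
lemma mem_nonloopEdges {x : V} {e : E} :
    e ∈ nonloopEdges ends x ↔ x ∈ ends e ∧ ¬ (ends e).IsDiag := by
  simp [nonloopEdges]

/-- A vertex with at most one non-loop edge is reached from `{r, s}` in at most one colour. -/
lemma not_mem_both_of_degree_le_one {r s x : V} (hx : (nonloopEdges ends x).card ≤ 1)
    (hr : x ≠ r) (hs : x ≠ s) {ω : Config E} (hK : x ∈ K2 ends r s ω)
    (hM : x ∈ M2 ends r s ω) : False := by
  -- in a colour in which `x` has no open non-loop edge, `x` is not reached
  have keyK : (∀ e, x ∈ ends e → ω e = true → (ends e).IsDiag) → False := by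
    intro h
    rcases mem_K2_iff.1 hK with hc | hc
    · exact hr (eq_of_conn_of_loops h hc).symm
    · exact hs (eq_of_conn_of_loops h hc).symm
  have keyM : (∀ e, x ∈ ends e → OneColourSwitch.compl ω e = true → (ends e).IsDiag) →
      False := by
    intro h
    rcases mem_M2_iff.1 hM with hc | hc
    · exact hr (eq_of_conn_of_loops h hc).symm
    · exact hs (eq_of_conn_of_loops h hc).symm
  rcases Nat.le_one_iff_eq_zero_or_eq_one.1 hx with h0 | h1
  · -- no non-loop edge at all
    have hall : ∀ e, x ∈ ends e → (ends e).IsDiag := by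
      intro e he
      by_contra hnd
      have : e ∈ nonloopEdges ends x := mem_nonloopEdges.2 ⟨he, hnd⟩
      rw [Finset.card_eq_zero.1 h0] at this
      exact absurd this (Finset.notMem_empty e)
    exact keyK (fun e he _ => hall e he)
  · obtain ⟨e₁, he₁⟩ := Finset.card_eq_one.1 h1
    have hone : ∀ e, x ∈ ends e → ¬ (ends e).IsDiag → e = e₁ := by
      intro e he hnd
      have : e ∈ nonloopEdges ends x := mem_nonloopEdges.2 ⟨he, hnd⟩
      rw [he₁] at this
      exact Finset.mem_singleton.1 this
    cases hc : ω e₁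
    · refine keyK ?_
      intro e he ho
      by_contra hnd
      rw [hone e he hnd] at ho
      rw [ho] at hc
      exact Bool.false_ne_true hc.symm
    · refine keyM ?_
      intro e he ho
      by_contra hnd
      rw [hone e he hnd] at ho
      simp [OneColourSwitch.compl, hc] at ho

/-- Under `Sep`, a non-mark adjacent to `p` or `q`, or with at most one non-loop edge, is never
in both worlds of `{r, s}`. -/
lemma DZero_of_adj_or_degree_le_one {p q r s : V}
    (hadj : ∀ x, Nonmark p q r s x →
      (∃ e, ends e = s(x, p) ∨ ends e = s(x, q)) ∨ (nonloopEdges ends x).card ≤ 1)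
    {ω : Config E} (h : sep2 ends p q r s ω) : DZero ends r s ω := by
  intro x hr hs hK hM
  obtain ⟨hpK, hqK⟩ := not_mem_K2_of_sep2 h
  obtain ⟨hpM, hqM⟩ := not_mem_M2_of_sep2 h
  rcases hadj x (nonmark_of_mem_U2 h (Or.inl hK) hr hs) with ⟨e, he | he⟩ | hdeg
  · cases hc : ω e
    · exact hpM (mem_M2_of_closed hM hc he)
    · exact hpK (mem_K2_of_open hK hc he)
  · cases hc : ω e
    · exact hqM (mem_M2_of_closed hM hc he)
    · exact hqK (mem_K2_of_open hK hc he)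
  · exact not_mem_both_of_degree_le_one hdeg hr hs hK hM

end Degree

section Reduce

variable [Fintype E] [DecidableEq E] {ends : E → Sym2 V}

/-- The non-loop edges of a graph with one more loop form a strictly smaller set. -/
lemma nonloopCount_update_loop_lt {e₀ : E} {d : V} (h : ¬ (ends e₀).IsDiag) :
    nonloopCount (Function.update ends e₀ s(d, d)) < nonloopCount ends := by
  unfold nonloopCount
  refine Finset.card_lt_card (Finset.ssubset_iff_of_subset ?_ |>.2 ⟨e₀, ?_, ?_⟩)
  · intro e he
    rw [Finset.mem_filter] at he ⊢
    refine ⟨Finset.mem_univ _, ?_⟩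
    by_cases hee : e = e₀
    · subst hee; simp at he
    · rw [Function.update_of_ne hee] at he; exact he.2
  · exact Finset.mem_filter.2 ⟨Finset.mem_univ _, h⟩
  · simp

/-- Non-loop edges at `z` after looping `e₀` are non-loop edges at `z` before. -/
lemma nonloopEdges_update_loop_subset (e₀ : E) (d z : V) :
    nonloopEdges (Function.update ends e₀ s(d, d)) z ⊆ nonloopEdges ends z := by
  intro e he
  rw [mem_nonloopEdges] at he ⊢
  by_cases hee : e = e₀
  · subst hee; simp at he
  · rw [Function.update_of_ne hee] at he; exact he

/-- An edge at `z` after the series replacement `e₁ ↦ {x, y}` (with `e₂` looped): either it is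
`e₁` with `z ∈ {x, y}`, or it is an old non-loop edge at `z` other than `e₂`. -/
lemma nonloopEdges_series_subset {e₁ e₂ : E} (hne : e₁ ≠ e₂) {x y : V} (d z : V) :
    nonloopEdges (Function.update (Function.update ends e₁ s(x, y)) e₂ s(d, d)) z ⊆
      insert e₁ ((nonloopEdges ends z).erase e₂) := by
  intro e he
  rw [mem_nonloopEdges] at he
  by_cases h2 : e = e₂
  · subst h2; simp at he
  by_cases h1 : e = e₁
  · subst h1; exact Finset.mem_insert_self _ _
  rw [Function.update_of_ne h2, Function.update_of_ne h1] at he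
  exact Finset.mem_insert_of_mem (Finset.mem_erase.2 ⟨h2, mem_nonloopEdges.2 he⟩)

/-- Strict decrease of the non-loop count under the series replacement. -/
lemma nonloopCount_series_lt {e₁ e₂ : E} (hne : e₁ ≠ e₂) {x y d : V}
    (h₁ : ends e₁ = s(d, x)) (h₂ : ends e₂ = s(d, y)) (hx : x ≠ d) (hy : y ≠ d) :
    nonloopCount (Function.update (Function.update ends e₁ s(x, y)) e₂ s(d, d)) <
      nonloopCount ends := by
  unfold nonloopCount
  refine Finset.card_lt_card (Finset.ssubset_iff_of_subset ?_ |>.2 ⟨e₂, ?_, ?_⟩)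
  · intro e he
    rw [Finset.mem_filter] at he ⊢
    refine ⟨Finset.mem_univ _, ?_⟩
    by_cases h2 : e = e₂
    · subst h2; simp at he
    by_cases h1 : e = e₁
    · subst h1; rw [h₁, Sym2.mk_isDiag_iff]; exact fun h => hx h.symm
    rw [Function.update_of_ne h2, Function.update_of_ne h1] at he
    exact he.2
  · refine Finset.mem_filter.2 ⟨Finset.mem_univ _, ?_⟩
    rw [h₂, Sym2.mk_isDiag_iff]; exact fun h => hy h.symm
  · simp

end Reduce

section Class

variable [Fintype V] [DecidableEq V] [Fintype E] [DecidableEq E] {ends : E → Sym2 V}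

omit [Fintype V] [DecidableEq V] [Fintype E] [DecidableEq E] in
/-- An edge at a non-mark `d` not adjacent to `p, q` is not an edge to `p` or `q`. -/
lemma ne_of_adj_edge {p q r s d v z : V} {e₀ e : E} (hd : Nonmark p q r s d)
    (hdadj : ¬ ∃ e, ends e = s(d, p) ∨ ends e = s(d, q)) (he₀ : ends e₀ = s(d, v))
    (he : ends e = s(z, p) ∨ ends e = s(z, q)) : e ≠ e₀ := by
  intro hee
  subst hee
  rw [he₀] at he
  rcases he with he | he
  · rcases Sym2.eq_iff.1 he with ⟨rfl, rfl⟩ | ⟨rfl, _⟩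
    · exact hdadj ⟨e, Or.inl he₀⟩
    · exact hd.1 rfl
  · rcases Sym2.eq_iff.1 he with ⟨rfl, rfl⟩ | ⟨rfl, _⟩
    · exact hdadj ⟨e, Or.inr he₀⟩
    · exact hd.2.1 rfl

/-- **`m9` in sign form on the class «every non-mark is adjacent to `p` or `q`, or has at most
two non-loop edges»**: `Σ_{Sep} σ_pq · σ_rs ≤ 0`. -/
theorem m9SignSum_nonpos_of_adj_or_degree_le_two {p q r s : V}
    (hadj : ∀ x, Nonmark p q r s x →
      (∃ e, ends e = s(x, p) ∨ ends e = s(x, q)) ∨ (nonloopEdges ends x).card ≤ 2) :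
    m9SignSum ends p q r s ≤ 0 := by
  suffices H : ∀ n, ∀ ends : E → Sym2 V, nonloopCount ends = n →
      (∀ x, Nonmark p q r s x →
        (∃ e, ends e = s(x, p) ∨ ends e = s(x, q)) ∨ (nonloopEdges ends x).card ≤ 2) →
      m9SignSum ends p q r s ≤ 0 from H _ ends rfl hadj
  intro n
  induction n using Nat.strong_induction_on with
  | _ n ih =>
  intro ends hn hadj
  by_cases hex : ∃ d, Nonmark p q r s d ∧ ¬ (∃ e, ends e = s(d, p) ∨ ends e = s(d, q)) ∧
      1 ≤ (nonloopEdges ends d).card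
  · obtain ⟨d, hdn, hdadj, hdeg⟩ := hex
    have hle2 : (nonloopEdges ends d).card ≤ 2 := (hadj d hdn).resolve_left hdadj
    have hp : p ≠ d := fun h => hdn.1 h.symm
    have hq : q ≠ d := fun h => hdn.2.1 h.symm
    have hr : r ≠ d := fun h => hdn.2.2.1 h.symm
    have hs : s ≠ d := fun h => hdn.2.2.2 h.symm
    rcases (show (nonloopEdges ends d).card = 1 ∨ (nonloopEdges ends d).card = 2 by omega)
      with h1 | h2
    · -- PENDANT: one non-loop edge `e₀ = {d, v}`; loop it
      obtain ⟨e₀, he₀⟩ := Finset.card_eq_one.1 h1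
      have hmem : e₀ ∈ nonloopEdges ends d := by rw [he₀]; exact Finset.mem_singleton_self _
      obtain ⟨hde₀, hnd₀⟩ := mem_nonloopEdges.1 hmem
      obtain ⟨v, hv⟩ := Sym2.mem_iff_exists.1 hde₀
      have hone : ∀ e, d ∈ ends e → ¬ (ends e).IsDiag → e = e₀ := by
        intro e he hnd
        have : e ∈ nonloopEdges ends d := mem_nonloopEdges.2 ⟨he, hnd⟩
        rw [he₀] at this
        exact Finset.mem_singleton.1 this
      rw [m9SignSum_pendant hone hv hp hq hr hs]
      refine ih _ (hn ▸ nonloopCount_update_loop_lt hnd₀) _ rfl ?_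
      intro z hz
      rcases hadj z hz with ⟨e, he⟩ | hdz
      · left
        refine ⟨e, ?_⟩
        rw [Function.update_of_ne (ne_of_adj_edge hdn hdadj hv he)]
        exact he
      · right
        exact le_trans (Finset.card_le_card (nonloopEdges_update_loop_subset e₀ d z)) hdz
    · -- SERIES: two non-loop edges `e₁ = {d, x}`, `e₂ = {d, y}`
      obtain ⟨e₁, e₂, hne, he⟩ := Finset.card_eq_two.1 h2
      have hmem₁ : e₁ ∈ nonloopEdges ends d := by rw [he]; simp
      have hmem₂ : e₂ ∈ nonloopEdges ends d := by rw [he]; simp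
      obtain ⟨hde₁, hnd₁⟩ := mem_nonloopEdges.1 hmem₁
      obtain ⟨hde₂, hnd₂⟩ := mem_nonloopEdges.1 hmem₂
      obtain ⟨x, hx⟩ := Sym2.mem_iff_exists.1 hde₁
      obtain ⟨y, hy⟩ := Sym2.mem_iff_exists.1 hde₂
      have hxd : x ≠ d := by
        intro h; subst h; rw [hx, Sym2.mk_isDiag_iff] at hnd₁; exact hnd₁ rfl
      have hyd : y ≠ d := by
        intro h; subst h; rw [hy, Sym2.mk_isDiag_iff] at hnd₂; exact hnd₂ rfl
      have htwo : ∀ e, d ∈ ends e → ¬ (ends e).IsDiag → e = e₁ ∨ e = e₂ := by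
        intro e he' hnd
        have : e ∈ nonloopEdges ends d := mem_nonloopEdges.2 ⟨he', hnd⟩
        rw [he] at this
        simpa using this
      have hid := m9SignSum_series (p := p) (q := q) (r := r) (s := s) hne htwo hx hy hxd hyd
        hp hq hr hs
      -- the two smaller graphs satisfy the class hypothesis
      have hG₁ : m9SignSum (Function.update (Function.update ends e₁ s(x, y)) e₂ s(d, d))
          p q r s ≤ 0 := by
        refine ih _ (hn ▸ nonloopCount_series_lt hne hx hy hxd hyd) _ rfl ?_
        intro z hz
        rcases hadj z hz with ⟨e, he'⟩ | hdz
        · left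
          refine ⟨e, ?_⟩
          rw [Function.update_of_ne (ne_of_adj_edge hdn hdadj hy he'),
            Function.update_of_ne (ne_of_adj_edge hdn hdadj hx he')]
          exact he'
        · right
          by_cases hzy : z = y
          · -- `z = y`: loses `e₂`, may gain `e₁`
            subst hzy
            have h2z : e₂ ∈ nonloopEdges ends z := mem_nonloopEdges.2 ⟨by
              rw [hy]; exact Sym2.mem_mk_right _ _, hnd₂⟩
            calc (nonloopEdges (Function.update (Function.update ends e₁ s(x, z)) e₂ s(d, d))
                  z).card
                ≤ (insert e₁ ((nonloopEdges ends z).erase e₂)).card :=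
                  Finset.card_le_card (nonloopEdges_series_subset hne d z)
              _ ≤ ((nonloopEdges ends z).erase e₂).card + 1 := Finset.card_insert_le _ _
              _ = (nonloopEdges ends z).card := by
                  rw [Finset.card_erase_of_mem h2z]
                  have : 1 ≤ (nonloopEdges ends z).card := Finset.card_pos.2 ⟨e₂, h2z⟩
                  omega
              _ ≤ 2 := hdz
          · -- `z ≠ y`: no new non-loop edge at `z`
            refine le_trans (Finset.card_le_card ?_) hdz
            intro e he'
            rw [mem_nonloopEdges] at he' ⊢
            by_cases h2 : e = e₂
            · subst h2; simp at he'
            by_cases h1 : e = e₁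
            · subst h1
              rw [Function.update_of_ne hne, Function.update_self] at he'
              rcases Sym2.mem_iff.1 he'.1 with rfl | rfl
              · exact ⟨by rw [hx]; exact Sym2.mem_mk_right _ _, hnd₁⟩
              · exact absurd rfl hzy
            rw [Function.update_of_ne h2, Function.update_of_ne h1] at he'
            exact he'
      have hG₀ : m9SignSum (Function.update (Function.update ends e₁ s(d, d)) e₂ s(d, d))
          p q r s ≤ 0 := by
        have hlt₁ : nonloopCount (Function.update ends e₁ s(d, d)) < nonloopCount ends :=
          nonloopCount_update_loop_lt hnd₁
        have hlt₂ : nonloopCount (Function.update (Function.update ends e₁ s(d, d)) e₂ s(d, d)) <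
            nonloopCount (Function.update ends e₁ s(d, d)) :=
          nonloopCount_update_loop_lt (by rw [Function.update_of_ne hne.symm]; exact hnd₂)
        refine ih _ (hn ▸ lt_trans hlt₂ hlt₁) _ rfl ?_
        intro z hz
        rcases hadj z hz with ⟨e, he'⟩ | hdz
        · left
          refine ⟨e, ?_⟩
          rw [Function.update_of_ne (ne_of_adj_edge hdn hdadj hy he'),
            Function.update_of_ne (ne_of_adj_edge hdn hdadj hx he')]
          exact he'
        · right
          exact le_trans (Finset.card_le_card (le_trans (nonloopEdges_update_loop_subset e₂ d z)
            (nonloopEdges_update_loop_subset e₁ d z))) hdz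
      linarith
  · -- BASE: every non-mark is adjacent to `p` or `q`, or has no non-loop edge
    apply m9SignSum_nonpos_of_DZero
    intro ω hω
    refine DZero_of_adj_or_degree_le_one ?_ hω
    intro z hz
    by_cases hza : ∃ e, ends e = s(z, p) ∨ ends e = s(z, q)
    · exact Or.inl hza
    · right
      have h0 : ¬ (1 ≤ (nonloopEdges ends z).card) := fun h => hex ⟨z, hz, hza, h⟩
      omega

end Class

end M9Reduce

end Summit.Ventures.PercRepro2
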